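import Literature.Barriers.CriticalPhenomena.WeaklySAWSojournSimplex
import Literature.Barriers.CriticalPhenomena.WeaklySAWReturnProbability
import Mathlib.Analysis.SpecialFunctions.Gamma.Basic
import Mathlib.Analysis.SpecificLimits.Normed
import HarnessLib

/-!
# The continuous-time weakly self-avoiding walk: `E I(T) ≤ 2TC₀(0)`, Jensen, and the lower bound
# `ν_c ≥ -2C₀(0)g` of Lemma A.1 of Bauerschmidt–Brydges–Slade 2015 (= the lower half of Theorem 1.2)

Companion to `WeaklySAWFourDimLogCorrections.lean` (definitions: `weightedExpectation`,
`survival = c_{g,T}`, `susceptibility = χ(g,ν)`, `criticalNu = ν_c`, `greenZero = C₀(0)`; named facts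
`BBS2015_thm12` = Theorem 1.2 and `BBS2015_lemA1` = Lemma A.1), on top of
`WeaklySAWFourDimLogCorrectionsProofs.lean` (volume `T^k/k!` of the sojourn simplex, walk counting
`(2d)^k`, `c_{0,T} = 1`, `c_{g,T} ≤ 1`, `ν_c ≤ 0`), `WeaklySAWSojournSimplex.lean` (the Dirichlet
moments `∫_{Δ_n(u)} σ_a σ_b = (1 + [a=b]) u^{n+2}/(n+2)!`) and `WeaklySAWReturnProbability.lean`
(transience of the simple random walk on `ℤ^d`, `d ≥ 3`: `summable_prob_zero`, the summability of
`n ↦ #{n-step walks 0 → 0}/(2d)ⁿ`, by the Fourier method). The sibling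
`WeaklySAWSusceptibilityLowerBound.lean` proves the other, all-dimensions, clause of the same lemma
with a cruder constant (`susceptibility_eq_top_of_le_neg`, `neg_le_criticalNu : -(2d+4g) ≤ ν_c` for
`d ≥ 1`); the two clauses of Lemma A.1 thus sit side by side. Source: R. Bauerschmidt,
D. C. Brydges, G. Slade, *Logarithmic correction for the susceptibility of the 4-dimensional weakly
self-avoiding walk: a renormalisation group analysis*, CMP 337 (2015), arXiv:1403.7422, Appendix A,
**Lemma A.1**, the clause "For `d > 2`, `ν_c ∈ [-2C₀(0)g, 0]`" and its printed proof: "By Jensen's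
inequality, `c_T = E(e^{-gI(T)}) ≥ e^{-gE(I(T))}`. An elementary estimate shows that
`E(I(T)) ≤ 2TC₀(0)`, and the Green function `C₀(x)` is finite for `d > 2`." This clause at
`d = 4` is the lower inequality of Theorem 1.2 (`BBS2015_thm12.lower_of_lemA1`).

## What is proved (namespace `Literature.Barriers.CriticalPhenomena.CTWSAW`)

* `lintegral_selfIntersection`: for a `k`-step skeleton `ω` and `T > 0`,
  `∫_{Δ_k(T)} I(ω,s) ds = Σ_{i,j ≤ k} 𝟙{ω(i) = ω(j)} (1 + δ_{ij}) T^{k+2}/(k+2)!`.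
* Words in the `2d` unit steps parametrise the `k`-step walks from `0` bijectively
  (`stepSigma`, `image_stepSigma`, `sum_walks_eq_sum_words`; injective + equal cardinalities
  `(2d)^k`), whence the product structure of the coincidence counts `card_coincidence`:
  `#{η : ω_η(i) = ω_η(j)} = (2d)^{k-(j-i)} R_{j-i}` for `i ≤ j ≤ k` (`R_m = closedWords d m`, the
  number of `m`-step walks `0 → 0`), and the row bound `row_coincidence_le`.
* `meanSelfIntersection d T = E₀ I(T)` (jump-chain form) and the "elementary estimate"
  **`meanSelfIntersection_le_greenSeries`**: `E₀ I(T) ≤ 2T · Σ_m R_m (2d)^{-(m+1)}`; the series is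
  the Green function at the origin in its time representation, `greenLintegral_eq_greenSeries`:
  `∫₀^∞ P₀(X(u) = 0) du = Σ_m R_m (2d)^{-(m+1)}` (Tonelli and the Gamma integral), whose `toReal`
  is `greenZero d = C₀(0)` by definition.
* Jensen's inequality in jump-chain form: `trajLintegral` (the expectation of a general
  non-negative functional of skeleton and sojourn times; additive, homogeneous, monotone, mass `1`)
  and `exp_neg_le_survival`: `E₀ I(T) ≤ m ⇒ c_{g,T} ≥ e^{-gm}` (integrate the tangent line of the
  convex `u ↦ e^{-gu}` at `m`).
* Hence, under the hypothesis `greenSeries d ≠ ∞` (finiteness of the Green function — transience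
  of the simple random walk; it forces `d > 0`): `exp_neg_greenZero_le_survival`
  (`c_{g,T} ≥ e^{-2C₀(0)gT}`), `susceptibility_eq_top_of_le_neg_greenZero_mul` (`χ(g,ν) = ∞` for
  `ν ≤ -2C₀(0)g`) and **`neg_two_greenZero_mul_le_criticalNu`**: `-2C₀(0) g ≤ ν_c(d,g)` for every
  `g ≥ 0`.
* The hypothesis holds for `d ≥ 3`: `closedWords_eq_card` (`R_m = #{m-step walks 0 → 0}`, the
  word/walk bijection), `greenSeries_eq_ofReal_tsum` and **`greenSeries_lt_top`** (from
  `summable_prob_zero`). Consequences: `neg_two_greenZero_mul_le_criticalNu_of_three_le`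
  (`-2C₀(0)g ≤ ν_c` for `d ≥ 3`, `g ≥ 0`), `susceptibility_eq_top_of_le_neg_greenZero_mul_of_three_le`,
  **`BBS2015_lemA1_clause_dgt2`** (the `d > 2` clause of Lemma A.1: `ν_c ∈ [-2C₀(0)g, 0]`, `g > 0`),
  **`BBS2015_thm12_lower`** (the lower inequality of Theorem 1.2, `d = 4`, every `g > 0`, proved
  outright), `BBS2015_thm12_of_upper` / `BBS2015_thm12_iff_upper'` (Theorem 1.2 is EQUIVALENT to its
  upper, renormalisation-group, inequality `BBS2015_thm12_upper`; with
  `WeaklySAWCriticalNuRGReduction.lean` it follows from `BBS2015_thm41_nu0c` and Lemma A.1), and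
  `greenZero_pos` (`C₀(0) > 0` for `d ≥ 3`; "`a = 2∫P(X(T)=0)dT > 0`", §1.3).

Auxiliary definitions (proof devices, [folklore]): `unitStep`, `stepPos`, `stepWalk`, `stepSigma`,
`walkSigma`, `closedWords`, `coincidenceWeight`, `simplexWeight`, `meanSelfIntersection`,
`greenSeries`, `greenLintegral`, `trajLintegral`.

Mathlib anchors: `Equiv.piEquivPiSubtypeProd`, `Fintype.equivFinOfCardEq`,
`Real.integral_rpow_mul_exp_neg_mul_Ioi`, `Real.Gamma_nat_eq_factorial`,
`integral_eq_lintegral_of_nonneg_ae`, `lintegral_tsum`, `Real.add_one_le_exp`,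
`NormedSpace.expSeries_div_hasSum_exp`, `le_csInf`.
-/

noncomputable section

open MeasureTheory Filter Topology Set Literature.Probability.LatticeModels
open scoped ENNReal BigOperators Nat

namespace Literature.Barriers.CriticalPhenomena.CTWSAW

variable {d : ℕ}

/-! ### The path integral of the self-intersection local time of a fixed skeleton -/

/-- The weight `(1 + δ_{ij}) T^{k+2}/(k+2)!` of a coincidence `ω(i) = ω(j)` in `E ∫ I`.
[folklore] -/
def coincidenceWeight (T : ℝ) (k i j : ℕ) : ℝ≥0∞ :=
  ENNReal.ofReal ((if i = j then 2 else 1) * T ^ (k + 2) / (k + 2)!)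

/-- **`∫_{Δ_k(T)} I(ω, s) ds = Σ_{i,j ≤ k} 𝟙{ω(i) = ω(j)} (1 + δ_{ij}) T^{k+2}/(k+2)!`** for a
`k`-step skeleton `ω` and `T > 0`: the self-intersection local time integrates, coincidence by
coincidence, to the Dirichlet second moments `lintegral_sojourns_mul_sojourns` of
`WeaklySAWSojournSimplex.lean`. [folklore] -/
theorem lintegral_selfIntersection {x : Site d} (ω : (zdGraph d).Walk 0 x) {T : ℝ} (hT : 0 < T) :
    ∫⁻ s in sojournSet ω.length T, ENNReal.ofReal (selfIntersection T ω s) =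
      ∑ i ∈ Finset.range (ω.length + 1), ∑ j ∈ Finset.range (ω.length + 1),
        if ω.getVert i = ω.getVert j then coincidenceWeight T ω.length i j else 0 := by
  have hterm : ∀ s ∈ sojournSet ω.length T, ∀ i j : Fin (ω.length + 1),
      0 ≤ (if ω.getVert i = ω.getVert j then sojourns T s i * sojourns T s j else 0) := by
    intro s hs i j
    split_ifs
    · exact (mul_pos (sojourns_pos hs i) (sojourns_pos hs j)).le
    · exact le_rfl
  have hsplit : ∀ s ∈ sojournSet ω.length T, ENNReal.ofReal (selfIntersection T ω s) =
      ∑ i : Fin (ω.length + 1), ∑ j : Fin (ω.length + 1),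
        ENNReal.ofReal (if ω.getVert i = ω.getVert j then sojourns T s i * sojourns T s j
          else 0) := by
    intro s hs
    unfold selfIntersection
    rw [ENNReal.ofReal_sum_of_nonneg fun i _ => Finset.sum_nonneg fun j _ => hterm s hs i j]
    exact Finset.sum_congr rfl fun i _ => ENNReal.ofReal_sum_of_nonneg fun j _ => hterm s hs i j
  have hmeas : ∀ i j : Fin (ω.length + 1), Measurable fun s : Fin ω.length → ℝ =>
      ENNReal.ofReal (if ω.getVert i = ω.getVert j then sojourns T s i * sojourns T s j
        else 0) := by
    intro i j
    by_cases h : ω.getVert i = ω.getVert j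
    · simp only [h, if_true]
      exact ((measurable_sojourns T _ i).mul (measurable_sojourns T _ j)).ennreal_ofReal
    · simp only [h, if_false, ENNReal.ofReal_zero]
      exact measurable_const
  rw [setLIntegral_congr_fun (measurableSet_sojournSet _ _) hsplit,
    lintegral_finsetSum _ fun i _ => Finset.measurable_sum _ fun j _ => hmeas i j,
    Finset.sum_range (fun i => ∑ j ∈ Finset.range (ω.length + 1),
      if ω.getVert i = ω.getVert j then coincidenceWeight T ω.length i j else 0)]
  refine Finset.sum_congr rfl fun i _ => ?_
  rw [lintegral_finsetSum _ fun j _ => hmeas i j,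
    Finset.sum_range (fun j => if ω.getVert i = ω.getVert j then
      coincidenceWeight T ω.length i j else 0)]
  refine Finset.sum_congr rfl fun j _ => ?_
  by_cases h : ω.getVert i = ω.getVert j
  · simp only [h, if_true, coincidenceWeight, Fin.val_inj]
    exact lintegral_sojourns_mul_sojourns _ hT i j
  · simp [h]


/-! ### Words in the `2d` unit steps: a product parametrisation of the `k`-step walks -/

/-- The `2d` unit steps `±eᵢ` of `ℤ^d`, indexed by `Fin d × Bool`. [folklore] -/
def unitStep (e : Fin d × Bool) : Site d :=
  if e.2 then Pi.single e.1 1 else -Pi.single e.1 1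

/-- `e ↦ ±eᵢ` is injective. [folklore] -/
theorem unitStep_injective : Function.Injective (unitStep (d := d)) := by
  intro e e' h
  apply step_injective (0 : Site d)
  rcases e with ⟨i, b⟩
  rcases e' with ⟨j, c⟩
  cases b <;> cases c <;> simpa [unitStep, sub_eq_add_neg] using h

/-- Adding a unit step is a nearest-neighbour move. [folklore] -/
theorem zdGraph_adj_add_unitStep (x : Site d) (e : Fin d × Bool) :
    (zdGraph d).Adj x (x + unitStep e) := by
  rw [zdGraph_adj_iff]
  rcases e with ⟨i, b⟩
  cases b
  · exact ⟨i, Or.inr (by simp [unitStep])⟩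
  · exact ⟨i, Or.inl (by simp [unitStep])⟩

/-- The position after `i` steps of the word `η` (frozen after `k` steps). [folklore] -/
def stepPos {k : ℕ} (η : Fin k → Fin d × Bool) (i : ℕ) : Site d :=
  ∑ l : Fin k, if (l : ℕ) < i then unitStep (η l) else 0

/-- The walk starts at the origin. [folklore] -/
theorem stepPos_zero {k : ℕ} (η : Fin k → Fin d × Bool) : stepPos η 0 = 0 := by
  simp [stepPos]

/-- One more step. [folklore] -/
theorem stepPos_succ {k : ℕ} (η : Fin k → Fin d × Bool) {i : ℕ} (hi : i < k) :
    stepPos η (i + 1) = stepPos η i + unitStep (η ⟨i, hi⟩) := by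
  unfold stepPos
  have h : ∀ l : Fin k, (if (l : ℕ) < i + 1 then unitStep (η l) else 0) =
      (if (l : ℕ) < i then unitStep (η l) else 0) + (if l = ⟨i, hi⟩ then unitStep (η l) else 0) := by
    intro l
    by_cases h1 : (l : ℕ) < i
    · have h2 : l ≠ ⟨i, hi⟩ := fun h => by simp [h] at h1
      simp [h1, h2, Nat.lt_succ_of_lt h1]
    · by_cases h2 : l = ⟨i, hi⟩
      · subst h2; simp
      · have h3 : ¬ (l : ℕ) < i + 1 := fun h => by
          rcases Nat.lt_succ_iff_lt_or_eq.1 h with h | h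
          · exact h1 h
          · exact h2 (Fin.ext h)
        simp [h1, h2, h3]
  simp_rw [h]
  rw [Finset.sum_add_distrib]
  simp

/-- After the last step the position is frozen. [folklore] -/
theorem stepPos_of_le {k : ℕ} (η : Fin k → Fin d × Bool) {i : ℕ} (hi : k ≤ i) :
    stepPos η i = stepPos η k := by
  unfold stepPos
  refine Finset.sum_congr rfl fun l _ => ?_
  rw [if_pos (lt_of_lt_of_le l.2 hi), if_pos l.2]

/-- The final position is the sum of all steps. [folklore] -/
theorem stepPos_self {k : ℕ} (η : Fin k → Fin d × Bool) : stepPos η k = ∑ l, unitStep (η l) := by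
  unfold stepPos
  exact Finset.sum_congr rfl fun l _ => if_pos l.2

/-- The nearest-neighbour walk traced by the word `η`. [folklore] -/
def stepWalk {k : ℕ} (η : Fin k → Fin d × Bool) : (zdGraph d).Walk (0 : Site d) (stepPos η k) :=
  (Literature.Probability.RandomPlanarGeometry.SAW.Zd.walkOfFn (stepPos η) k (fun i hi => by
    rw [stepPos_succ η hi]; exact zdGraph_adj_add_unitStep _ _)).copy (stepPos_zero η) rfl

/-- The traced walk has length `k`. [folklore] -/
@[simp] theorem length_stepWalk {k : ℕ} (η : Fin k → Fin d × Bool) : (stepWalk η).length = k := by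
  simp [stepWalk]

/-- The vertices of the traced walk are the partial sums of the word. [folklore] -/
theorem getVert_stepWalk {k : ℕ} (η : Fin k → Fin d × Bool) (i : ℕ) :
    (stepWalk η).getVert i = stepPos η (min i k) := by
  simp [stepWalk, Literature.Probability.RandomPlanarGeometry.SAW.Zd.getVert_walkOfFn]

variable (d) in
/-- The traced walk as an element of `Σ x, Walk 0 x`. [folklore] -/
def stepSigma (k : ℕ) (η : Fin k → Fin d × Bool) : Σ x : Site d, (zdGraph d).Walk (0 : Site d) x :=
  ⟨stepPos η k, stepWalk η⟩

/-- Different words trace different walks. [folklore] -/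
theorem stepSigma_injective (k : ℕ) : Function.Injective (stepSigma d k) := by
  intro η η' h
  have hv : ∀ i, stepPos η (min i k) = stepPos η' (min i k) := by
    intro i
    have := congrArg (fun p : Σ x : Site d, (zdGraph d).Walk (0 : Site d) x => p.2.getVert i) h
    simpa [stepSigma, getVert_stepWalk] using this
  funext l
  have h1 := hv l
  have h2 := hv (l + 1)
  rw [min_eq_left (le_of_lt l.2)] at h1
  rw [min_eq_left (Nat.succ_le_of_lt l.2), stepPos_succ η l.2, stepPos_succ η' l.2, h1] at h2
  exact unitStep_injective (add_left_cancel h2)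

variable (d) in
/-- All `k`-step walks from the origin, as a finite set of `Σ x, Walk 0 x` (endpoints range over
`box d k`, which contains them all). [folklore] -/
def walkSigma (k : ℕ) : Finset (Σ x : Site d, (zdGraph d).Walk (0 : Site d) x) :=
  (box d k).sigma fun x => (zdGraph d).finsetWalkLength k (0 : Site d) x

/-- There are `(2d)^k` of them. [folklore] -/
theorem card_walkSigma (k : ℕ) : (walkSigma d k).card = (2 * d) ^ k := by
  rw [walkSigma, Finset.card_sigma, sum_card_finsetWalkLength_zdGraph]

/-- Traced walks are `k`-step walks from the origin. [folklore] -/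
theorem stepSigma_mem {k : ℕ} (η : Fin k → Fin d × Bool) : stepSigma d k η ∈ walkSigma d k := by
  rw [walkSigma, Finset.mem_sigma]
  exact ⟨Literature.Probability.RandomPlanarGeometry.SAW.Zd.mem_box_of_walk (stepWalk η)
    (length_stepWalk η).le, SimpleGraph.mem_finsetWalkLength_iff.2 (length_stepWalk η)⟩

/-- **Words parametrise walks**: tracing is a bijection from the `(2d)^k` words onto the `(2d)^k`
walks of length `k` from the origin (injective, into, equal cardinalities). [folklore] -/
theorem image_stepSigma (k : ℕ) :
    (Finset.univ : Finset (Fin k → Fin d × Bool)).image (stepSigma d k) = walkSigma d k := by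
  apply Finset.eq_of_subset_of_card_le
  · intro p hp
    obtain ⟨η, -, rfl⟩ := Finset.mem_image.1 hp
    exact stepSigma_mem η
  · rw [card_walkSigma, Finset.card_image_of_injective _ (stepSigma_injective k),
      Finset.card_univ, Fintype.card_fun, Fintype.card_prod, Fintype.card_fin, Fintype.card_fin,
      Fintype.card_bool, Nat.mul_comm d 2]

/-- Transport of sums over `k`-step walks to sums over words. [folklore] -/
theorem sum_walks_eq_sum_words {M : Type*} [AddCommMonoid M] (k : ℕ)
    (F : (Σ x : Site d, (zdGraph d).Walk (0 : Site d) x) → M) :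
    ∑ x ∈ box d k, ∑ ω ∈ (zdGraph d).finsetWalkLength k (0 : Site d) x, F ⟨x, ω⟩ =
      ∑ η : Fin k → Fin d × Bool, F (stepSigma d k η) := by
  rw [← Finset.sum_sigma, ← walkSigma, ← image_stepSigma,
    Finset.sum_image fun η _ η' _ h => stepSigma_injective k h]

variable (d) in
/-- The number `R_m` of closed words of length `m` (= `m`-step walks from `0` to `0`). [folklore] -/
def closedWords (m : ℕ) : ℕ :=
  (Finset.univ.filter fun ζ : Fin m → Fin d × Bool => ∑ l, unitStep (ζ l) = 0).card

/-- The number of `m`-step walks returning to the origin, in the jump-chain bookkeeping, is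
`closedWords d m`. [folklore] -/
theorem sum_indicator_origin_eq_closedWords (m : ℕ) :
    ∑ x ∈ box d m, ∑ _ω ∈ (zdGraph d).finsetWalkLength m (0 : Site d) x,
      (if x = 0 then (1 : ℝ≥0∞) else 0) = closedWords d m := by
  rw [sum_walks_eq_sum_words m (fun p => if p.1 = 0 then (1 : ℝ≥0∞) else 0)]
  simp only [stepSigma, stepPos_self]
  rw [Finset.sum_boole, closedWords]


/-! ### Coincidence counts: `#{η : ω_η(i) = ω_η(j)} = (2d)^{k-(j-i)} R_{j-i}` -/

/-- **Coincidence count.** For `i ≤ j ≤ k`, the number of words of length `k` whose partial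
sums after `i` and after `j` steps agree is `(2d)^{k-(j-i)} R_{j-i}`: the block of steps
`i, …, j-1` must be a closed word, the other `k - (j - i)` steps are free. [folklore] -/
theorem card_coincidence {k i j : ℕ} (hij : i ≤ j) (hjk : j ≤ k) :
    (Finset.univ.filter fun η : Fin k → Fin d × Bool => stepPos η i = stepPos η j).card =
      (2 * d) ^ (k - (j - i)) * closedWords d (j - i) := by
  classical
  set P : Fin k → Prop := fun l => i ≤ (l : ℕ) ∧ (l : ℕ) < j with hP
  -- 1. the coincidence is a condition on the block of steps `i ≤ l < j`
  have hblock : ∀ η : Fin k → Fin d × Bool,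
      stepPos η j = stepPos η i + ∑ l : {l // P l}, unitStep (η l) := by
    intro η
    unfold stepPos
    rw [← Finset.sum_subtype (Finset.univ.filter P) (by simp) (fun l => unitStep (η l)),
      Finset.sum_filter, ← Finset.sum_add_distrib]
    refine Finset.sum_congr rfl fun l _ => ?_
    by_cases h1 : (l : ℕ) < i
    · simp [h1, lt_of_lt_of_le h1 hij]
    · by_cases h2 : (l : ℕ) < j
      · simp [h1, h2]
      · simp [h1, h2]
  have hiff : ∀ η : Fin k → Fin d × Bool,
      stepPos η i = stepPos η j ↔ ∑ l : {l // P l}, unitStep (η l) = 0 := by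
    intro η
    rw [hblock η]
    constructor
    · intro h
      exact add_left_cancel (a := stepPos η i) (by rw [← h, add_zero])
    · intro h
      rw [h, add_zero]
  -- 2. product decomposition of the words along `P`
  let e := Equiv.piEquivPiSubtypeProd P (fun _ : Fin k => Fin d × Bool)
  have hcard : Fintype.card {η : Fin k → Fin d × Bool // stepPos η i = stepPos η j} =
      Fintype.card {w : {l // P l} → Fin d × Bool // ∑ l, unitStep (w l) = 0} *
        Fintype.card ({l // ¬ P l} → Fin d × Bool) := by
    rw [← Fintype.card_prod]
    refine Fintype.card_congr ((Equiv.subtypeEquiv e fun η => ?_).trans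
      (Equiv.prodSubtypeFstEquivSubtypeProd
        (p := fun w : {l // P l} → Fin d × Bool => ∑ l, unitStep (w l) = 0)))
    rw [hiff]
    rfl
  -- 3. cardinalities of the two blocks of indices
  have hcardP : Fintype.card {l // P l} = j - i := by
    rw [Fintype.card_subtype]
    have : (Finset.univ.filter P).map Fin.valEmbedding = Finset.Ico i j := by
      ext n
      simp only [Finset.mem_map, Finset.mem_filter, Finset.mem_univ, true_and,
        Fin.valEmbedding_apply, Finset.mem_Ico, hP]
      constructor
      · rintro ⟨l, ⟨h1, h2⟩, rfl⟩
        exact ⟨h1, h2⟩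
      · rintro ⟨h1, h2⟩
        exact ⟨⟨n, lt_of_lt_of_le h2 hjk⟩, ⟨h1, h2⟩, rfl⟩
    rw [← Finset.card_map, this, Nat.card_Ico]
  have hcardnP : Fintype.card {l // ¬ P l} = k - (j - i) := by
    rw [Fintype.card_subtype_compl, hcardP, Fintype.card_fin]
  -- 4. the closed block
  have hclosed : Fintype.card {w : {l // P l} → Fin d × Bool // ∑ l, unitStep (w l) = 0} =
      closedWords d (j - i) := by
    let f : {l // P l} ≃ Fin (j - i) := Fintype.equivFinOfCardEq hcardP
    rw [closedWords, ← Fintype.card_subtype]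
    refine Fintype.card_congr (Equiv.subtypeEquiv (Equiv.arrowCongr f (Equiv.refl _)) fun w => ?_)
    rw [← Equiv.sum_comp f.symm (fun l => unitStep (w l))]
    rfl
  -- 5. assemble
  rw [← Fintype.card_subtype, hcard, hclosed, Fintype.card_fun, hcardnP, Fintype.card_prod,
    Fintype.card_fin, Fintype.card_bool, Nat.mul_comm d 2, Nat.mul_comm]

/-- The diagonal count: every word coincides with itself. [folklore] -/
theorem card_coincidence_self (k i : ℕ) :
    (Finset.univ.filter fun η : Fin k → Fin d × Bool => stepPos η i = stepPos η i).card =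
      (2 * d) ^ k := by
  rw [Finset.filter_true_of_mem fun _ _ => rfl, Finset.card_univ, Fintype.card_fun,
    Fintype.card_prod, Fintype.card_fin, Fintype.card_fin, Fintype.card_bool, Nat.mul_comm d 2]

/-- There is exactly one closed word of length `0`. [folklore] -/
theorem closedWords_zero (d : ℕ) : closedWords d 0 = 1 := by
  simp [closedWords]

/-- **Row bound for the coincidence matrix.** For `i ≤ k`, with the diagonal counted twice,
`2·#{η : ω(i)=ω(i)} + Σ_{j ≠ i, j ≤ k} #{η : ω(i) = ω(j)} ≤ 2 Σ_{m ≤ k} (2d)^{k-m} R_m`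
(the maps `j ↦ |i - j|` are injective on each side of the diagonal). [folklore] -/
theorem row_coincidence_le (k i : ℕ) (hi : i ≤ k) :
    2 * (Finset.univ.filter fun η : Fin k → Fin d × Bool => stepPos η i = stepPos η i).card +
      ∑ j ∈ (Finset.range (k + 1)).erase i,
        (Finset.univ.filter fun η : Fin k → Fin d × Bool => stepPos η i = stepPos η j).card ≤
      2 * ∑ m ∈ Finset.range (k + 1), (2 * d) ^ (k - m) * closedWords d m := by
  set g : ℕ → ℕ := fun m => (2 * d) ^ (k - m) * closedWords d m with hg
  -- split the off-diagonal sum into `j < i` and `i < j ≤ k`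
  have hsplit : (Finset.range (k + 1)).erase i = Finset.range i ∪ Finset.Ioc i k := by
    ext j
    simp only [Finset.mem_erase, Finset.mem_range, Finset.mem_union, Finset.mem_Ioc]
    omega
  have hdisj : Disjoint (Finset.range i) (Finset.Ioc i k) := by
    rw [Finset.disjoint_left]
    intro j h1 h2
    simp only [Finset.mem_range] at h1
    simp only [Finset.mem_Ioc] at h2
    omega
  -- left part: `j < i`, coincidence count `g (i - j)`
  have hleft : ∑ j ∈ Finset.range i,
      (Finset.univ.filter fun η : Fin k → Fin d × Bool => stepPos η i = stepPos η j).card ≤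
      ∑ m ∈ Finset.Ioc 0 k, g m := by
    have h1 : ∀ j ∈ Finset.range i,
        (Finset.univ.filter fun η : Fin k → Fin d × Bool => stepPos η i = stepPos η j).card =
          g (i - j) := by
      intro j hj
      rw [Finset.mem_range] at hj
      have := card_coincidence (d := d) hj.le hi
      rw [hg]
      simp only
      rw [← this]
      congr 1
      ext η
      simp only [Finset.mem_filter, Finset.mem_univ, true_and]
      exact eq_comm
    rw [Finset.sum_congr rfl h1, ← Finset.sum_image (g := fun j => i - j)
      (fun j₁ h₁ j₂ h₂ h => by
        simp only [Finset.coe_range, Set.mem_Iio] at h₁ h₂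
        simp only at h; omega)]
    refine Finset.sum_le_sum_of_subset fun m hm => ?_
    simp only [Finset.mem_image, Finset.mem_range] at hm
    obtain ⟨j, hj, rfl⟩ := hm
    simp only [Finset.mem_Ioc]
    omega
  -- right part: `i < j ≤ k`, coincidence count `g (j - i)`
  have hright : ∑ j ∈ Finset.Ioc i k,
      (Finset.univ.filter fun η : Fin k → Fin d × Bool => stepPos η i = stepPos η j).card ≤
      ∑ m ∈ Finset.Ioc 0 k, g m := by
    have h1 : ∀ j ∈ Finset.Ioc i k,
        (Finset.univ.filter fun η : Fin k → Fin d × Bool => stepPos η i = stepPos η j).card =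
          g (j - i) := by
      intro j hj
      rw [Finset.mem_Ioc] at hj
      rw [card_coincidence (d := d) hj.1.le hj.2]
    rw [Finset.sum_congr rfl h1, ← Finset.sum_image (g := fun j => j - i)
      (fun j₁ h₁ j₂ h₂ h => by
        simp only [Finset.coe_Ioc, Set.mem_Ioc] at h₁ h₂
        simp only at h; omega)]
    refine Finset.sum_le_sum_of_subset fun m hm => ?_
    simp only [Finset.mem_image, Finset.mem_Ioc] at hm
    obtain ⟨j, hj, rfl⟩ := hm
    simp only [Finset.mem_Ioc]
    omega
  -- the diagonal
  have hdiag : (Finset.univ.filter fun η : Fin k → Fin d × Bool => stepPos η i = stepPos η i).card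
      = g 0 := by
    rw [card_coincidence_self, hg]
    simp [closedWords_zero]
  -- `Σ_{m ≤ k} g m = g 0 + Σ_{0 < m ≤ k} g m`
  have htot : ∑ m ∈ Finset.range (k + 1), g m = g 0 + ∑ m ∈ Finset.Ioc 0 k, g m := by
    have : Finset.range (k + 1) = insert 0 (Finset.Ioc 0 k) := by
      ext m
      simp only [Finset.mem_range, Finset.mem_insert, Finset.mem_Ioc]
      omega
    rw [this, Finset.sum_insert (by simp)]
  rw [hsplit, Finset.sum_union hdisj, hdiag, htot]
  linarith [hleft, hright]


/-! ### The mean self-intersection local time `E₀ I(T)` in jump-chain form, and its layers -/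

variable (d) in
/-- `E₀[I(T)] = e^{-2dT} Σ_k Σ_{|ω| = k} ∫_{Δ_k(T)} I(ω, s) ds ∈ [0, ∞]`, the mean self-intersection
local time of the rate-`2d` walk on `[0, T]` in the jump-chain representation of
`weightedExpectation`. [cite: BauerschmidtBrydgesSlade2015LogCorr, Lemma A.1 (proof: E(I(T)))] -/
def meanSelfIntersection (T : ℝ) : ℝ≥0∞ :=
  ENNReal.ofReal (Real.exp (-(2 * d) * T)) *
    ∑' k : ℕ, ∑ x ∈ box d k, ∑ ω ∈ (zdGraph d).finsetWalkLength k (0 : Site d) x,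
      ∫⁻ s in sojournSet ω.length T, ENNReal.ofReal (selfIntersection T ω s)

/-- The simplex factor `B_k = T^{k+2}/(k+2)!` of the coincidence weights. [folklore] -/
def simplexWeight (T : ℝ) (k : ℕ) : ℝ≥0∞ := ENNReal.ofReal (T ^ (k + 2) / (k + 2)!)

/-- `coincidenceWeight = (1 + δ_{ij}) · B_k`. [folklore] -/
theorem coincidenceWeight_eq (T : ℝ) (k i j : ℕ) :
    coincidenceWeight T k i j = (if i = j then 2 else 1) * simplexWeight T k := by
  unfold coincidenceWeight simplexWeight
  rw [mul_div_assoc, ENNReal.ofReal_mul (by split_ifs <;> norm_num)]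
  split_ifs <;> simp

/-- The `k`-th layer of `E₀ I(T)` in terms of coincidence counts of words:
`Σ_{|ω|=k} ∫ I = Σ_{i,j ≤ k} w_{ij} · #{η : ω_η(i) = ω_η(j)}`. [folklore] -/
theorem layer_selfIntersection_eq (k : ℕ) {T : ℝ} (hT : 0 < T) :
    ∑ x ∈ box d k, ∑ ω ∈ (zdGraph d).finsetWalkLength k (0 : Site d) x,
        ∫⁻ s in sojournSet ω.length T, ENNReal.ofReal (selfIntersection T ω s) =
      ∑ i ∈ Finset.range (k + 1), ∑ j ∈ Finset.range (k + 1), coincidenceWeight T k i j *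
        ((Finset.univ.filter fun η : Fin k → Fin d × Bool => stepPos η i = stepPos η j).card :
          ℝ≥0∞) := by
  -- each skeleton contributes its coincidence sum
  have h1 : ∀ x ∈ box d k, ∀ ω ∈ (zdGraph d).finsetWalkLength k (0 : Site d) x,
      ∫⁻ s in sojournSet ω.length T, ENNReal.ofReal (selfIntersection T ω s) =
        ∑ i ∈ Finset.range (k + 1), ∑ j ∈ Finset.range (k + 1),
          if ω.getVert i = ω.getVert j then coincidenceWeight T k i j else 0 := by
    intro x _ ω hω
    rw [lintegral_selfIntersection ω hT, SimpleGraph.mem_finsetWalkLength_iff.1 hω]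
  rw [Finset.sum_congr rfl fun x hx => Finset.sum_congr rfl (h1 x hx)]
  -- transport to words
  rw [sum_walks_eq_sum_words k (fun p => ∑ i ∈ Finset.range (k + 1), ∑ j ∈ Finset.range (k + 1),
      if p.2.getVert i = p.2.getVert j then coincidenceWeight T k i j else 0)]
  simp only [stepSigma, getVert_stepWalk]
  rw [Finset.sum_comm]
  refine Finset.sum_congr rfl fun i hi => ?_
  rw [Finset.sum_comm]
  refine Finset.sum_congr rfl fun j hj => ?_
  rw [Finset.mem_range, Nat.lt_succ_iff] at hi hj
  simp only [min_eq_left hi, min_eq_left hj]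
  rw [← Finset.sum_filter, Finset.sum_const, nsmul_eq_mul, mul_comm]

/-- **Layer bound.** `Σ_{|ω| = k} ∫_{Δ_k(T)} I ≤ (k+1) · 2B_k · Σ_{m ≤ k} (2d)^{k-m} R_m`
(`row_coincidence_le` row by row). [folklore] -/
theorem layer_selfIntersection_le (k : ℕ) {T : ℝ} (hT : 0 < T) :
    ∑ x ∈ box d k, ∑ ω ∈ (zdGraph d).finsetWalkLength k (0 : Site d) x,
        ∫⁻ s in sojournSet ω.length T, ENNReal.ofReal (selfIntersection T ω s) ≤
      (k + 1 : ℝ≥0∞) * (simplexWeight T k *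
        (2 * ∑ m ∈ Finset.range (k + 1), ((2 * d) ^ (k - m) * closedWords d m : ℕ) : ℝ≥0∞)) := by
  rw [layer_selfIntersection_eq k hT]
  have hrow : ∀ i ∈ Finset.range (k + 1), ∑ j ∈ Finset.range (k + 1), coincidenceWeight T k i j *
      ((Finset.univ.filter fun η : Fin k → Fin d × Bool => stepPos η i = stepPos η j).card :
        ℝ≥0∞) ≤ simplexWeight T k *
        (2 * ∑ m ∈ Finset.range (k + 1), ((2 * d) ^ (k - m) * closedWords d m : ℕ) : ℝ≥0∞) := by
    intro i hi
    rw [Finset.mem_range, Nat.lt_succ_iff] at hi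
    rw [← Finset.add_sum_erase _ _ (Finset.mem_range.2 (Nat.lt_succ_of_le hi))]
    have hoff : ∀ j ∈ (Finset.range (k + 1)).erase i, coincidenceWeight T k i j *
        ((Finset.univ.filter fun η : Fin k → Fin d × Bool => stepPos η i = stepPos η j).card :
          ℝ≥0∞) = simplexWeight T k *
        ((Finset.univ.filter fun η : Fin k → Fin d × Bool => stepPos η i = stepPos η j).card :
          ℝ≥0∞) := by
      intro j hj
      rw [coincidenceWeight_eq T, if_neg (Finset.ne_of_mem_erase hj).symm, one_mul]
    rw [Finset.sum_congr rfl hoff, ← Finset.mul_sum, coincidenceWeight_eq T, if_pos rfl,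
      mul_assoc, mul_left_comm, ← mul_add]
    gcongr
    exact_mod_cast row_coincidence_le (d := d) k i hi
  calc _ ≤ ∑ _i ∈ Finset.range (k + 1), simplexWeight T k *
        (2 * ∑ m ∈ Finset.range (k + 1), ((2 * d) ^ (k - m) * closedWords d m : ℕ) : ℝ≥0∞) :=
        Finset.sum_le_sum hrow
    _ = _ := by rw [Finset.sum_const, Finset.card_range, nsmul_eq_mul]; push_cast; ring


/-! ### Summing the layers: `E₀ I(T) ≤ 2T · Σ_m R_m (2d)^{-(m+1)}` -/

variable (d) in
/-- The Green function of the simple random walk at the origin as a series over closed words,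
`Σ_m R_m (2d)^{-(m+1)}` (`= ∫₀^∞ P(X_u = 0) du = C₀(0)`, see `greenLintegral_eq_greenSeries`).
[folklore] -/
def greenSeries : ℝ≥0∞ := ∑' m : ℕ, (closedWords d m : ℝ≥0∞) * (2 * d : ℝ≥0∞)⁻¹ ^ (m + 1)

/-- The elementary real inequality behind the layer comparison:
`(k+1) T^{k+2}/(k+2)! · Dⁿ ≤ T (DT)^{k+1}/(k+1)! · D^{-(m+1)}` for `k = m + n`. [folklore] -/
theorem layer_term_le_real {D T : ℝ} (hD : 0 < D) (hT : 0 ≤ T) (m n : ℕ) :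
    (m + n + 1 : ℝ) * (T ^ (m + n + 2) / (m + n + 2)!) * D ^ n ≤
      T * ((D * T) ^ (m + n + 1) / (m + n + 1)!) * D⁻¹ ^ (m + 1) := by
  have hF : (0 : ℝ) < (m + n + 1)! := by positivity
  have hfac : ((m + n + 2)! : ℝ) = (m + n + 2) * (m + n + 1)! := by
    rw [show m + n + 2 = (m + n + 1) + 1 from rfl, Nat.factorial_succ]; push_cast; ring
  have hsplit : D ^ (m + n + 1) = D ^ n * D ^ (m + 1) := by
    rw [← pow_add]; congr 1; ring
  have key : T * ((D * T) ^ (m + n + 1) / (m + n + 1)!) * D⁻¹ ^ (m + 1) =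
      T ^ (m + n + 2) / (m + n + 1)! * D ^ n := by
    rw [mul_pow, hsplit, inv_pow]
    field_simp
    ring
  rw [key, hfac]
  calc (m + n + 1 : ℝ) * (T ^ (m + n + 2) / ((m + n + 2) * (m + n + 1)!)) * D ^ n
      = (m + n + 1) / (m + n + 2) * (T ^ (m + n + 2) / (m + n + 1)! * D ^ n) := by
        field_simp
    _ ≤ 1 * (T ^ (m + n + 2) / (m + n + 1)! * D ^ n) := by
        gcongr
        rw [div_le_one (by positivity)]; linarith
    _ = _ := one_mul _

/-- The same inequality in `ℝ≥0∞` with the bookkeeping of `simplexWeight`: for `m ≤ k`, `d > 0`,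
`(k+1) · B_k · (2d)^{k-m} ≤ T · (2dT)^{k+1}/(k+1)! · (2d)^{-(m+1)}`. [folklore] -/
theorem layer_term_le (hd : 0 < d) {T : ℝ} (hT : 0 ≤ T) {k m : ℕ} (hm : m ≤ k) :
    (k + 1 : ℝ≥0∞) * simplexWeight T k * ((2 * d) ^ (k - m) : ℕ) ≤
      ENNReal.ofReal T * ENNReal.ofReal ((2 * d * T) ^ (k + 1) / (k + 1)!) *
        (2 * d : ℝ≥0∞)⁻¹ ^ (m + 1) := by
  have h2d : (0 : ℝ) < 2 * d := by positivity
  have hk1 : (k + 1 : ℝ≥0∞) = ENNReal.ofReal (k + 1) := by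
    rw [ENNReal.ofReal_add (by positivity) zero_le_one, ENNReal.ofReal_natCast, ENNReal.ofReal_one]
  have hpow : (((2 * d) ^ (k - m) : ℕ) : ℝ≥0∞) = ENNReal.ofReal ((2 * d : ℝ) ^ (k - m)) := by
    rw [ENNReal.ofReal_pow h2d.le, ← two_mul_natCast_eq_ofReal]; push_cast; rfl
  have hinv : (2 * d : ℝ≥0∞)⁻¹ ^ (m + 1) = ENNReal.ofReal (((2 * d : ℝ)⁻¹) ^ (m + 1)) := by
    rw [ENNReal.ofReal_pow (inv_nonneg.2 h2d.le), ENNReal.ofReal_inv_of_pos h2d,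
      ← two_mul_natCast_eq_ofReal]
  rw [hk1, simplexWeight, hpow, hinv, ← ENNReal.ofReal_mul (by positivity),
    ← ENNReal.ofReal_mul (by positivity), ← ENNReal.ofReal_mul hT,
    ← ENNReal.ofReal_mul (by positivity)]
  refine ENNReal.ofReal_le_ofReal ?_
  obtain ⟨n, rfl⟩ := Nat.exists_eq_add_of_le hm
  rw [Nat.add_sub_cancel_left]
  have := layer_term_le_real h2d hT m n
  push_cast at this ⊢
  exact this


/-- For `d = 0` the Green series is infinite (the walk never moves). [folklore] -/
theorem greenSeries_zero : greenSeries 0 = ∞ := by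
  rw [greenSeries]
  refine ENNReal.tsum_eq_top_of_eq_top ⟨0, ?_⟩
  simp [closedWords_zero]

/-- **Layer comparison.** For `d > 0`, `T > 0` and every `k`:
`Σ_{|ω|=k} ∫_{Δ_k(T)} I ≤ 2T · (2dT)^{k+1}/(k+1)! · Σ_m R_m (2d)^{-(m+1)}`. [folklore] -/
theorem layer_selfIntersection_le_greenSeries (hd : 0 < d) (k : ℕ) {T : ℝ} (hT : 0 < T) :
    ∑ x ∈ box d k, ∑ ω ∈ (zdGraph d).finsetWalkLength k (0 : Site d) x,
        ∫⁻ s in sojournSet ω.length T, ENNReal.ofReal (selfIntersection T ω s) ≤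
      2 * ENNReal.ofReal T * ENNReal.ofReal ((2 * d * T) ^ (k + 1) / (k + 1)!) * greenSeries d := by
  refine (layer_selfIntersection_le k hT).trans ?_
  have hsum : (k + 1 : ℝ≥0∞) * (simplexWeight T k *
      (2 * ∑ m ∈ Finset.range (k + 1), ((2 * d) ^ (k - m) * closedWords d m : ℕ) : ℝ≥0∞)) =
      2 * ∑ m ∈ Finset.range (k + 1), ((k + 1 : ℝ≥0∞) * simplexWeight T k * ((2 * d) ^ (k - m) : ℕ)) *
        (closedWords d m : ℝ≥0∞) := by
    push_cast
    rw [Finset.mul_sum, Finset.mul_sum, Finset.mul_sum, Finset.mul_sum]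
    refine Finset.sum_congr rfl fun m _ => ?_
    ring
  rw [hsum]
  calc 2 * ∑ m ∈ Finset.range (k + 1), ((k + 1 : ℝ≥0∞) * simplexWeight T k * ((2 * d) ^ (k - m) : ℕ)) *
        (closedWords d m : ℝ≥0∞)
      ≤ 2 * ∑ m ∈ Finset.range (k + 1), (ENNReal.ofReal T *
          ENNReal.ofReal ((2 * d * T) ^ (k + 1) / (k + 1)!) * (2 * d : ℝ≥0∞)⁻¹ ^ (m + 1)) *
          (closedWords d m : ℝ≥0∞) := by
        refine mul_le_mul' le_rfl (Finset.sum_le_sum fun m hm => mul_le_mul' ?_ le_rfl)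
        exact layer_term_le hd hT.le (Nat.lt_succ_iff.1 (Finset.mem_range.1 hm))
    _ = 2 * ENNReal.ofReal T * ENNReal.ofReal ((2 * d * T) ^ (k + 1) / (k + 1)!) *
          ∑ m ∈ Finset.range (k + 1), (closedWords d m : ℝ≥0∞) * (2 * d : ℝ≥0∞)⁻¹ ^ (m + 1) := by
        rw [Finset.mul_sum, Finset.mul_sum]
        refine Finset.sum_congr rfl fun m _ => ?_
        ring
    _ ≤ _ := by
        gcongr
        exact ENNReal.sum_le_tsum _

/-- **`E₀ I(T) ≤ 2T · Σ_m R_m (2d)^{-(m+1)}`** (`= 2T C₀(0)`): the "elementary estimate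
`E(I(T)) ≤ 2TC₀(0)`" of the proof of Lemma A.1, in jump-chain form.
[cite: BauerschmidtBrydgesSlade2015LogCorr, Lemma A.1 (proof)] -/
theorem meanSelfIntersection_le_greenSeries (d : ℕ) {T : ℝ} (hT : 0 < T) :
    meanSelfIntersection d T ≤ 2 * ENNReal.ofReal T * greenSeries d := by
  rcases Nat.eq_zero_or_pos d with rfl | hd
  · rw [greenSeries_zero, ENNReal.mul_top (by simp [hT])]
    exact le_top
  unfold meanSelfIntersection
  calc ENNReal.ofReal (Real.exp (-(2 * d) * T)) *
        ∑' k : ℕ, ∑ x ∈ box d k, ∑ ω ∈ (zdGraph d).finsetWalkLength k (0 : Site d) x,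
          ∫⁻ s in sojournSet ω.length T, ENNReal.ofReal (selfIntersection T ω s)
      ≤ ENNReal.ofReal (Real.exp (-(2 * d) * T)) *
        ∑' k : ℕ, 2 * ENNReal.ofReal T * ENNReal.ofReal ((2 * d * T) ^ (k + 1) / (k + 1)!) *
          greenSeries d :=
        mul_le_mul' le_rfl (ENNReal.tsum_le_tsum fun k =>
          layer_selfIntersection_le_greenSeries hd k hT)
    _ = ENNReal.ofReal (Real.exp (-(2 * d) * T)) * (2 * ENNReal.ofReal T * greenSeries d *
        ∑' k : ℕ, ENNReal.ofReal ((2 * d * T) ^ (k + 1) / (k + 1)!)) := by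
        congr 1
        rw [← ENNReal.tsum_mul_left]
        exact tsum_congr fun k => by ring
    _ ≤ ENNReal.ofReal (Real.exp (-(2 * d) * T)) * (2 * ENNReal.ofReal T * greenSeries d *
        ENNReal.ofReal (Real.exp (2 * d * T))) := by
        gcongr
        have hexp : ∑' p : ℕ, ENNReal.ofReal ((2 * d * T) ^ p / p !) =
            ENNReal.ofReal (Real.exp (2 * d * T)) := by
          rw [← ENNReal.ofReal_tsum_of_nonneg (fun k => by positivity)
            (Real.summable_pow_div_factorial _)]
          congr 1
          rw [Real.exp_eq_exp_ℝ]
          exact (NormedSpace.expSeries_div_hasSum_exp (2 * d * T)).tsum_eq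
        rw [← hexp]
        exact ENNReal.tsum_comp_le_tsum_of_injective Nat.succ_injective
          (fun p => ENNReal.ofReal ((2 * d * T) ^ p / p !))
    _ = 2 * ENNReal.ofReal T * greenSeries d := by
        rw [mul_comm (ENNReal.ofReal _), mul_assoc, ← ENNReal.ofReal_mul (Real.exp_pos _).le,
          ← Real.exp_add]
        norm_num


/-! ### The Green function at the origin: `∫₀^∞ P(X_u = 0) du = Σ_m R_m (2d)^{-(m+1)}` -/

variable (d) in
/-- `∫₀^∞ P₀(X(u) = 0) du ∈ [0, ∞]`, the lintegral whose real part is `greenZero d = C₀(0)`.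
[cite: BauerschmidtBrydgesSlade2015LogCorr, §1.2 (C₀(0))] -/
def greenLintegral : ℝ≥0∞ :=
  ∫⁻ u in Ioi (0 : ℝ), weightedExpectation d 0 u fun x => if x = 0 then 1 else 0

/-- `greenZero d = (greenLintegral d).toReal` (definitional).
[cite: BauerschmidtBrydgesSlade2015LogCorr, §1.2 (C₀(0))] -/
theorem greenZero_eq_toReal (d : ℕ) : greenZero d = (greenLintegral d).toReal := rfl

/-- The inverse powers `(2d)^{-(m+1)}` as `ofReal`. [folklore] -/
theorem inv_two_mul_pow_eq_ofReal (hd : 0 < d) (n : ℕ) :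
    (2 * d : ℝ≥0∞)⁻¹ ^ n = ENNReal.ofReal (((2 * d : ℝ)⁻¹) ^ n) := by
  have h2d : (0 : ℝ) < 2 * d := by positivity
  rw [ENNReal.ofReal_pow (inv_nonneg.2 h2d.le), ENNReal.ofReal_inv_of_pos h2d,
    ← two_mul_natCast_eq_ofReal]

/-- The Gamma integral `∫₀^∞ uᵐ e^{-ru} du = m!/r^{m+1}` (`r > 0`) as a lintegral. [folklore] -/
theorem lintegral_pow_mul_exp_neg_mul (m : ℕ) {r : ℝ} (hr : 0 < r) :
    ∫⁻ u in Ioi (0 : ℝ), ENNReal.ofReal (u ^ m * Real.exp (-(r * u))) =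
      ENNReal.ofReal (m ! / r ^ (m + 1)) := by
  have hint : ∫ u in Ioi (0 : ℝ), u ^ m * Real.exp (-(r * u)) = m ! / r ^ (m + 1) := by
    have h := Real.integral_rpow_mul_exp_neg_mul_Ioi (a := (m : ℝ) + 1) (r := r) (by positivity) hr
    simp only [add_sub_cancel_right, Real.rpow_natCast] at h
    rw [h, Real.Gamma_nat_eq_factorial, show ((m : ℝ) + 1) = ((m + 1 : ℕ) : ℝ) by push_cast; ring,
      Real.rpow_natCast, one_div, inv_pow]
    field_simp
  have hnn : 0 ≤ᵐ[volume.restrict (Ioi (0 : ℝ))] fun u => u ^ m * Real.exp (-(r * u)) :=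
    (ae_restrict_iff' measurableSet_Ioi).2 (ae_of_all _ fun u (hu : 0 < u) => by positivity)
  have hmeas : AEStronglyMeasurable (fun u : ℝ => u ^ m * Real.exp (-(r * u)))
      (volume.restrict (Ioi 0)) :=
    (by fun_prop : Continuous fun u : ℝ => u ^ m * Real.exp (-(r * u))).aestronglyMeasurable
  have h2 := integral_eq_lintegral_of_nonneg_ae hnn hmeas
  rw [hint] at h2
  have hpos : (0 : ℝ) < m ! / r ^ (m + 1) := by positivity
  have hne : ∫⁻ u in Ioi (0 : ℝ), ENNReal.ofReal (u ^ m * Real.exp (-(r * u))) ≠ ∞ := by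
    intro htop
    rw [htop, ENNReal.toReal_top] at h2
    exact hpos.ne' h2
  rw [← ENNReal.ofReal_toReal hne, ← h2]

/-- `P₀(X(u) = 0) = e^{-2du} Σ_m R_m uᵐ/m!` for `u > 0`: the return probability in jump-chain
form. [folklore] -/
theorem weightedExpectation_origin {u : ℝ} (hu : 0 < u) :
    weightedExpectation d 0 u (fun x => if x = 0 then 1 else 0) =
      ∑' m : ℕ, (closedWords d m : ℝ≥0∞) *
        ENNReal.ofReal ((m ! : ℝ)⁻¹ * (u ^ m * Real.exp (-((2 * d) * u)))) := by
  unfold weightedExpectation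
  rw [← ENNReal.tsum_mul_left]
  refine tsum_congr fun m => ?_
  have h : ∀ x ∈ box d m, ∀ ω ∈ (zdGraph d).finsetWalkLength m (0 : Site d) x,
      (if x = 0 then (1 : ℝ≥0∞) else 0) * pathIntegral 0 u ω =
        (if x = 0 then (1 : ℝ≥0∞) else 0) * ENNReal.ofReal (u ^ m / m !) := by
    intro x _ ω hω
    rw [pathIntegral_zero_left, volume_sojournSet, if_pos hu,
      SimpleGraph.mem_finsetWalkLength_iff.1 hω]
  rw [Finset.sum_congr rfl fun x hx => Finset.sum_congr rfl (h x hx)]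
  simp_rw [← Finset.sum_mul]
  rw [sum_indicator_origin_eq_closedWords, ← mul_assoc, mul_comm (ENNReal.ofReal _), mul_assoc,
    ← ENNReal.ofReal_mul (by positivity)]
  congr 2
  rw [neg_mul]
  field_simp

/-- **`∫₀^∞ P₀(X(u) = 0) du = Σ_m R_m (2d)^{-(m+1)}`** (`d > 0`): the Green function at the
origin, time representation versus closed-word series (Tonelli and the Gamma integral).
[folklore] -/
theorem greenLintegral_eq_greenSeries (hd : 0 < d) : greenLintegral d = greenSeries d := by
  have h2d : (0 : ℝ) < 2 * d := by positivity
  unfold greenLintegral greenSeries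
  rw [setLIntegral_congr_fun measurableSet_Ioi fun u hu => weightedExpectation_origin (d := d) hu,
    lintegral_tsum fun m => ?_]
  swap
  · exact (measurable_const.mul (by fun_prop : Measurable fun u : ℝ =>
      ENNReal.ofReal ((m ! : ℝ)⁻¹ * (u ^ m * Real.exp (-((2 * d) * u)))))).aemeasurable
  refine tsum_congr fun m => ?_
  rw [lintegral_const_mul _ (by fun_prop)]
  congr 1
  have h1 : ∀ u : ℝ, ENNReal.ofReal ((m ! : ℝ)⁻¹ * (u ^ m * Real.exp (-((2 * d) * u)))) =
      ENNReal.ofReal ((m ! : ℝ)⁻¹) * ENNReal.ofReal (u ^ m * Real.exp (-((2 * d) * u))) :=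
    fun u => ENNReal.ofReal_mul (by positivity)
  simp_rw [h1]
  rw [lintegral_const_mul _ (by fun_prop), lintegral_pow_mul_exp_neg_mul m h2d,
    ← ENNReal.ofReal_mul (by positivity), inv_two_mul_pow_eq_ofReal hd]
  congr 1
  rw [inv_pow]
  field_simp


/-! ### Jensen's inequality in jump-chain form: `c_T ≥ e^{-g E I(T)}` -/

/-- The jump-chain expectation `E₀[F(skeleton, sojourn times)]` of a non-negative functional of
the trajectory on `[0, T]` (`weightedExpectation` is the case `F = Φ(X(T)) e^{-gI}`).
[cite: BauerschmidtBrydgesSlade2015LogCorr, §1.1 (E_a)] -/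
def trajLintegral (d : ℕ) (T : ℝ)
    (F : (p : Σ x : Site d, (zdGraph d).Walk (0 : Site d) x) → (Fin p.2.length → ℝ) → ℝ≥0∞) :
    ℝ≥0∞ :=
  ENNReal.ofReal (Real.exp (-(2 * d) * T)) *
    ∑' k : ℕ, ∑ x ∈ box d k, ∑ ω ∈ (zdGraph d).finsetWalkLength k (0 : Site d) x,
      ∫⁻ s in sojournSet ω.length T, F ⟨x, ω⟩ s

/-- `c_{g,T} = E₀[e^{-gI(T)}]`. [cite: BauerschmidtBrydgesSlade2015LogCorr, §1.1 (c_T)] -/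
theorem survival_eq_trajLintegral (d : ℕ) (g T : ℝ) :
    survival d g T = trajLintegral d T fun p s =>
      ENNReal.ofReal (Real.exp (-g * selfIntersection T p.2 s)) := by
  unfold survival weightedExpectation trajLintegral pathIntegral
  simp_rw [one_mul]

/-- `E₀ I(T)` is the expectation of the functional `I`. [folklore] -/
theorem meanSelfIntersection_eq_trajLintegral (d : ℕ) (T : ℝ) :
    meanSelfIntersection d T = trajLintegral d T fun p s =>
      ENNReal.ofReal (selfIntersection T p.2 s) := rfl

/-- Monotonicity of the expectation (pointwise on the sojourn simplices). [folklore] -/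
theorem trajLintegral_mono {T : ℝ}
    {F G : (p : Σ x : Site d, (zdGraph d).Walk (0 : Site d) x) → (Fin p.2.length → ℝ) → ℝ≥0∞}
    (h : ∀ (p : Σ x : Site d, (zdGraph d).Walk (0 : Site d) x),
      ∀ s ∈ sojournSet p.2.length T, F p s ≤ G p s) :
    trajLintegral d T F ≤ trajLintegral d T G := by
  unfold trajLintegral
  refine mul_le_mul' le_rfl (ENNReal.tsum_le_tsum fun k => Finset.sum_le_sum fun x _ =>
    Finset.sum_le_sum fun ω _ => setLIntegral_mono' (measurableSet_sojournSet _ _) fun s hs => ?_)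
  exact h ⟨x, ω⟩ s hs

/-- Additivity of the expectation. [folklore] -/
theorem trajLintegral_add {T : ℝ}
    {F G : (p : Σ x : Site d, (zdGraph d).Walk (0 : Site d) x) → (Fin p.2.length → ℝ) → ℝ≥0∞}
    (hF : ∀ p, Measurable (F p)) :
    trajLintegral d T (fun p s => F p s + G p s) = trajLintegral d T F + trajLintegral d T G := by
  unfold trajLintegral
  rw [← mul_add, ← ENNReal.tsum_add]
  congr 1
  refine tsum_congr fun k => ?_
  rw [← Finset.sum_add_distrib]
  refine Finset.sum_congr rfl fun x _ => ?_
  rw [← Finset.sum_add_distrib]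
  refine Finset.sum_congr rfl fun ω _ => ?_
  exact lintegral_add_left (hF ⟨x, ω⟩) _

/-- Homogeneity of the expectation. [folklore] -/
theorem trajLintegral_const_mul {T : ℝ} (c : ℝ≥0∞) (hc : c ≠ ∞)
    (F : (p : Σ x : Site d, (zdGraph d).Walk (0 : Site d) x) → (Fin p.2.length → ℝ) → ℝ≥0∞) :
    trajLintegral d T (fun p s => c * F p s) = c * trajLintegral d T F := by
  unfold trajLintegral
  rw [mul_left_comm]
  congr 1
  rw [← ENNReal.tsum_mul_left]
  refine tsum_congr fun k => ?_
  rw [Finset.mul_sum]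
  refine Finset.sum_congr rfl fun x _ => ?_
  rw [Finset.mul_sum]
  refine Finset.sum_congr rfl fun ω _ => ?_
  exact lintegral_const_mul' c _ hc

/-- The expectation of the constant `1` is the total mass `c_{0,T} = 1` (`T > 0`).
[cite: BauerschmidtBrydgesSlade2015LogCorr, §1.1] -/
theorem trajLintegral_one (d : ℕ) {T : ℝ} (hT : 0 < T) :
    trajLintegral d T (fun _ _ => 1) = 1 := by
  have h := survival_zero_left d hT
  rw [survival_eq_trajLintegral] at h
  simpa using h

/-- The self-intersection local time is a measurable function of the sojourns. [folklore] -/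
theorem measurable_selfIntersection (T : ℝ) {x : Site d} (ω : (zdGraph d).Walk 0 x) :
    Measurable fun s => selfIntersection T ω s := by
  unfold selfIntersection
  refine Finset.measurable_sum _ fun i _ => Finset.measurable_sum _ fun j _ => ?_
  by_cases h : ω.getVert i = ω.getVert j
  · simp only [h, if_true]
    exact (measurable_sojourns T _ i).mul (measurable_sojourns T _ j)
  · simp only [h, if_false]
    exact measurable_const

/-- The tangent-line (Jensen) inequality for `u ↦ e^{-gu}` at `m`, in the arrangement with
non-negative terms: `e^{-gm}(1 + gm) ≤ e^{-gI} + g e^{-gm} I`. [folklore] -/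
theorem exp_tangent_le {g : ℝ} (I m : ℝ) :
    Real.exp (-g * m) * (1 + g * m) ≤ Real.exp (-g * I) + g * Real.exp (-g * m) * I := by
  have h1 := Real.add_one_le_exp (-g * (I - m))
  have h2 : Real.exp (-g * m) * Real.exp (-g * (I - m)) = Real.exp (-g * I) := by
    rw [← Real.exp_add]; congr 1; ring
  nlinarith [mul_le_mul_of_nonneg_left h1 (Real.exp_pos (-g * m)).le, h2]

/-- **Jensen's inequality, jump-chain form.** If `E₀ I(T) ≤ m` then
`c_{g,T} = E₀ e^{-gI(T)} ≥ e^{-gm}` (`g ≥ 0`, `T > 0`); the proof integrates the tangent line of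
the convex function `u ↦ e^{-gu}` at `m` against the (probability) law of the trajectory.
[cite: BauerschmidtBrydgesSlade2015LogCorr, Lemma A.1 (proof: Jensen)] -/
theorem exp_neg_le_survival {g T m : ℝ} (hg : 0 ≤ g) (hT : 0 < T) (hm : 0 ≤ m)
    (hmean : meanSelfIntersection d T ≤ ENNReal.ofReal m) :
    ENNReal.ofReal (Real.exp (-g * m)) ≤ survival d g T := by
  set c₀ : ℝ≥0∞ := ENNReal.ofReal (Real.exp (-g * m) * (1 + g * m)) with hc₀
  set c₁ : ℝ≥0∞ := ENNReal.ofReal (g * Real.exp (-g * m)) with hc₁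
  -- the tangent-line inequality, pointwise on the sojourn simplices
  have hptw : ∀ (p : Σ x : Site d, (zdGraph d).Walk (0 : Site d) x),
      ∀ s ∈ sojournSet p.2.length T,
      c₀ * 1 ≤ ENNReal.ofReal (Real.exp (-g * selfIntersection T p.2 s)) +
          c₁ * ENNReal.ofReal (selfIntersection T p.2 s) := by
    intro p s hs
    have hI := selfIntersection_nonneg p.2 hs
    rw [mul_one, hc₀, hc₁, ← ENNReal.ofReal_mul (by positivity),
      ← ENNReal.ofReal_add (by positivity) (by positivity)]
    refine ENNReal.ofReal_le_ofReal ?_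
    have htan : Real.exp (-g * m) * (1 + g * m) ≤ Real.exp (-g * selfIntersection T p.2 s) +
        g * Real.exp (-g * m) * selfIntersection T p.2 s := exp_tangent_le _ m
    linarith
  -- integrate it
  have hint := trajLintegral_mono (d := d) (T := T) (F := fun _ _ => c₀ * 1)
    (G := fun p s => ENNReal.ofReal (Real.exp (-g * selfIntersection T p.2 s)) +
      c₁ * ENNReal.ofReal (selfIntersection T p.2 s)) hptw
  rw [trajLintegral_add fun p =>
      (((measurable_selfIntersection T p.2).const_mul (-g)).exp).ennreal_ofReal,
    trajLintegral_const_mul c₁ ENNReal.ofReal_ne_top, trajLintegral_const_mul c₀ ENNReal.ofReal_ne_top,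
    trajLintegral_one d hT, mul_one, ← survival_eq_trajLintegral,
    ← meanSelfIntersection_eq_trajLintegral] at hint
  -- `c₀ = e^{-gm} + c₁ m`, then cancel `c₁ m`
  have hsplit : c₀ = ENNReal.ofReal (Real.exp (-g * m)) + c₁ * ENNReal.ofReal m := by
    rw [hc₀, hc₁, ← ENNReal.ofReal_mul (by positivity), ← ENNReal.ofReal_add (by positivity)
      (by positivity)]
    congr 1; ring
  rw [hsplit] at hint
  have hfin : c₁ * ENNReal.ofReal m ≠ ∞ :=
    ENNReal.mul_ne_top ENNReal.ofReal_ne_top ENNReal.ofReal_ne_top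
  refine (ENNReal.add_le_add_iff_right hfin).1 (hint.trans ?_)
  exact add_le_add le_rfl (mul_le_mul' le_rfl hmean)

/-! ### The lower bound `ν_c ≥ -2C₀(0) g` -/

/-- If the Green series is finite then `d > 0`. [folklore] -/
theorem pos_of_greenSeries_ne_top (h : greenSeries d ≠ ∞) : 0 < d := by
  rcases Nat.eq_zero_or_pos d with rfl | hd
  · exact absurd greenSeries_zero h
  · exact hd

/-- With a finite Green function, `c_{g,T} ≥ e^{-2C₀(0) g T}` for all `T > 0`, `g ≥ 0`.
[cite: BauerschmidtBrydgesSlade2015LogCorr, Lemma A.1 (proof)] -/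
theorem exp_neg_greenZero_le_survival (hG : greenSeries d ≠ ∞) {g : ℝ} (hg : 0 ≤ g) {T : ℝ}
    (hT : 0 < T) : ENNReal.ofReal (Real.exp (-g * (2 * greenZero d * T))) ≤ survival d g T := by
  have hd := pos_of_greenSeries_ne_top hG
  have hGZ : greenZero d = (greenSeries d).toReal := by
    rw [greenZero_eq_toReal, greenLintegral_eq_greenSeries hd]
  refine exp_neg_le_survival hg hT (by rw [hGZ]; positivity) ?_
  calc meanSelfIntersection d T ≤ 2 * ENNReal.ofReal T * greenSeries d :=
        meanSelfIntersection_le_greenSeries d hT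
    _ = ENNReal.ofReal (2 * greenZero d * T) := by
        rw [hGZ, mul_right_comm, ENNReal.ofReal_mul (by positivity), ENNReal.ofReal_mul (by norm_num),
          ENNReal.ofReal_ofNat, ENNReal.ofReal_toReal hG]

/-- Below `-2C₀(0)g` the susceptibility diverges: `χ(g,ν) = ∞` for `ν ≤ -2C₀(0) g`
(`c_T e^{-νT} ≥ 1`). [cite: BauerschmidtBrydgesSlade2015LogCorr, Lemma A.1 (proof)] -/
theorem susceptibility_eq_top_of_le_neg_greenZero_mul (hG : greenSeries d ≠ ∞) {g : ℝ} (hg : 0 ≤ g) {ν : ℝ}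
    (hν : ν ≤ -(2 * greenZero d * g)) : susceptibility d g ν = ∞ := by
  unfold susceptibility
  refine eq_top_iff.2 ?_
  calc (⊤ : ℝ≥0∞) = ∫⁻ _ in Ioi (0 : ℝ), 1 := by
        rw [setLIntegral_one, Real.volume_Ioi]
    _ ≤ ∫⁻ T in Ioi (0 : ℝ), survival d g T * ENNReal.ofReal (Real.exp (-ν * T)) := by
        refine setLIntegral_mono' measurableSet_Ioi fun T hT => ?_
        have hT : 0 < T := hT
        calc (1 : ℝ≥0∞) ≤ ENNReal.ofReal (Real.exp (-g * (2 * greenZero d * T)) * Real.exp (-ν * T)) := by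
              rw [← Real.exp_add, ← ENNReal.ofReal_one]
              refine ENNReal.ofReal_le_ofReal (Real.one_le_exp ?_)
              have : 0 ≤ -(2 * greenZero d * g + ν) * T := mul_nonneg (by linarith) hT.le
              linarith [this]
          _ = ENNReal.ofReal (Real.exp (-g * (2 * greenZero d * T))) *
                ENNReal.ofReal (Real.exp (-ν * T)) := ENNReal.ofReal_mul (Real.exp_pos _).le
          _ ≤ _ := mul_le_mul' (exp_neg_greenZero_le_survival hG hg hT) le_rfl


/-- **Lower bound of Lemma A.1 (given a finite Green function):** `-2C₀(0) g ≤ ν_c(d, g)` for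
`g ≥ 0`, where `C₀(0) = greenZero d`; the finiteness hypothesis `Σ_m R_m (2d)^{-(m+1)} < ∞` is
transience of the simple random walk, which holds for `d ≥ 3` (`greenSeries_lt_top` below, from
`summable_prob_zero` of `WeaklySAWReturnProbability.lean`); the unconditional `d ≥ 3` form is
`neg_two_greenZero_mul_le_criticalNu_of_three_le`. [cite: BauerschmidtBrydgesSlade2015LogCorr, Lemma A.1] -/
theorem neg_two_greenZero_mul_le_criticalNu (hG : greenSeries d ≠ ∞) {g : ℝ} (hg : 0 ≤ g) :
    -(2 * greenZero d * g) ≤ criticalNu d g := by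
  unfold criticalNu
  refine le_csInf ⟨1, susceptibility_lt_top hg d one_pos⟩ fun ν hν => le_of_lt (lt_of_not_ge fun h => ?_)
  exact (lt_top_iff_ne_top.1 hν) (susceptibility_eq_top_of_le_neg_greenZero_mul hG hg h)



/-! ### Closed words are the walks `0 → 0` -/

/-- `R_m = closedWords d m` is the number of `m`-step nearest-neighbour walks from `0` to `0`.
[folklore] -/
theorem closedWords_eq_card (d m : ℕ) :
    closedWords d m = ((zdGraph d).finsetWalkLength m (0 : Site d) 0).card := by
  have h := sum_indicator_origin_eq_closedWords (d := d) m
  have h2 : ∑ x ∈ box d m, ∑ _ω ∈ (zdGraph d).finsetWalkLength m (0 : Site d) x,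
      (if x = 0 then (1 : ℝ≥0∞) else 0) = ((zdGraph d).finsetWalkLength m (0 : Site d) 0).card := by
    rw [← Finset.add_sum_erase _ _ (zero_mem_box d m)]
    simp only [if_true, Finset.sum_const, nsmul_eq_mul, mul_one]
    rw [Finset.sum_eq_zero fun x hx => ?_, add_zero]
    simp [Finset.ne_of_mem_erase hx]
  rw [h2] at h
  exact_mod_cast h.symm

/-! ### Finiteness of the Green series for `d ≥ 3` -/

/-- `Σ_m R_m (2d)^{-(m+1)} = ofReal((2d)⁻¹ Σ_m p_m(0))` with `p_m(0) = R_m/(2d)^m`, for `d > 0`, given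
summability of the return probabilities. [folklore] -/
theorem greenSeries_eq_ofReal_tsum (hd : 0 < d)
    (hs : Summable fun n : ℕ =>
      (((zdGraph d).finsetWalkLength n (0 : Site d) 0).card : ℝ) / (2 * (d : ℝ)) ^ n) :
    greenSeries d = ENNReal.ofReal ((2 * (d : ℝ))⁻¹ *
      ∑' n : ℕ, (((zdGraph d).finsetWalkLength n (0 : Site d) 0).card : ℝ) / (2 * (d : ℝ)) ^ n) := by
  have h2d : (0 : ℝ) < 2 * d := by positivity
  rw [← tsum_mul_left, ENNReal.ofReal_tsum_of_nonneg (fun n => by positivity) (hs.mul_left _),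
    greenSeries]
  refine tsum_congr fun m => ?_
  rw [closedWords_eq_card, inv_two_mul_pow_eq_ofReal hd, ← ENNReal.ofReal_natCast,
    ← ENNReal.ofReal_mul (Nat.cast_nonneg _)]
  congr 1
  rw [pow_succ, inv_pow]
  field_simp

/-- **Transience input, `d ≥ 3`: the Green function at the origin is finite**,
`Σ_m R_m (2d)^{-(m+1)} < ∞` ("the Green function `C₀(x)` is finite for `d > 2`", Lemma A.1), from
`summable_prob_zero` of `WeaklySAWReturnProbability.lean`. [cite: BauerschmidtBrydgesSlade2015LogCorr, Lemma A.1 (proof)] -/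
theorem greenSeries_lt_top (hd : 3 ≤ d) : greenSeries d < ∞ := by
  rw [greenSeries_eq_ofReal_tsum (by omega) (summable_prob_zero hd)]
  exact ENNReal.ofReal_lt_top

/-! ### Consequences: the `d > 2` clause of Lemma A.1 and the lower half of Theorem 1.2 -/

/-- **Lower bound of Lemma A.1, unconditionally for `d ≥ 3`**: `-2C₀(0) g ≤ ν_c(d,g)` for `g ≥ 0`.
[cite: BauerschmidtBrydgesSlade2015LogCorr, Lemma A.1] -/
theorem neg_two_greenZero_mul_le_criticalNu_of_three_le (hd : 3 ≤ d) {g : ℝ} (hg : 0 ≤ g) :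
    -(2 * greenZero d * g) ≤ criticalNu d g :=
  neg_two_greenZero_mul_le_criticalNu (greenSeries_lt_top hd).ne hg

/-- For `d ≥ 3` the susceptibility diverges at and below `-2C₀(0)g`: `χ(g,ν) = ∞` for
`ν ≤ -2C₀(0)g`, `g ≥ 0`. [cite: BauerschmidtBrydgesSlade2015LogCorr, Lemma A.1 (proof)] -/
theorem susceptibility_eq_top_of_le_neg_greenZero_mul_of_three_le (hd : 3 ≤ d) {g : ℝ} (hg : 0 ≤ g)
    {ν : ℝ} (hν : ν ≤ -(2 * greenZero d * g)) : susceptibility d g ν = ∞ :=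
  susceptibility_eq_top_of_le_neg_greenZero_mul (greenSeries_lt_top hd).ne hg hν

/-- **The `d > 2` clause of Lemma A.1**, proved: for `d > 2` and `g > 0`,
`ν_c(d,g) ∈ [-2C₀(0)g, 0]`. [cite: BauerschmidtBrydgesSlade2015LogCorr, Lemma A.1] -/
theorem BBS2015_lemA1_clause_dgt2 (hd : 2 < d) {g : ℝ} (hg : 0 < g) :
    -(2 * greenZero d * g) ≤ criticalNu d g ∧ criticalNu d g ≤ 0 :=
  ⟨neg_two_greenZero_mul_le_criticalNu_of_three_le hd hg.le, criticalNu_le_zero hg.le d⟩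

/-- **The lower inequality of Theorem 1.2, proved outright**: for `d = 4` and every `g > 0`,
`-ag ≤ ν_c(g)` with `a = 2C₀(0)`. [cite: BauerschmidtBrydgesSlade2015LogCorr, Theorem 1.2 and Lemma A.1] -/
theorem BBS2015_thm12_lower (g : ℝ) (hg : 0 < g) : -(2 * greenZero 4 * g) ≤ criticalNu 4 g :=
  neg_two_greenZero_mul_le_criticalNu_of_three_le (by norm_num) hg.le

/-- Theorem 1.2 follows from its upper (renormalisation-group) inequality alone.
[cite: BauerschmidtBrydgesSlade2015LogCorr, Theorem 1.2] -/
theorem BBS2015_thm12_of_upper (h : BBS2015_thm12_upper) : BBS2015_thm12 :=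
  BBS2015_thm12_of_lower_of_upper BBS2015_thm12_lower h

/-- **Theorem 1.2 is equivalent to its upper inequality** `ν_c(g) ≤ -ag + Cg²` (the lower one
being proved). [cite: BauerschmidtBrydgesSlade2015LogCorr, Theorem 1.2] -/
theorem BBS2015_thm12_iff_upper' : BBS2015_thm12 ↔ BBS2015_thm12_upper :=
  ⟨BBS2015_thm12.upper, BBS2015_thm12_of_upper⟩

/-- `C₀(0) > 0` for `d ≥ 3` (the walk spends a positive expected time `≥ 1/(2d)` at the origin:
the `m = 0` term of the Green series). [cite: BauerschmidtBrydgesSlade2015LogCorr, §1.3 ("Since a = 2∫P(X(T)=0)dT > 0")] -/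
theorem greenZero_pos (hd : 3 ≤ d) : 0 < greenZero d := by
  have hd0 : 0 < d := by omega
  rw [greenZero_eq_toReal, greenLintegral_eq_greenSeries hd0]
  refine ENNReal.toReal_pos (ne_of_gt ?_) (greenSeries_lt_top hd).ne
  rw [greenSeries]
  refine lt_of_lt_of_le ?_ (ENNReal.le_tsum 0)
  rw [closedWords_zero, Nat.cast_one, one_mul, zero_add, pow_one, ENNReal.inv_pos]
  exact ENNReal.mul_ne_top (by simp) (ENNReal.natCast_ne_top d)

end Literature.Barriers.CriticalPhenomena.CTWSAW
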